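import Mathlib.Analysis.InnerProductSpace.PiL2
import Mathlib.Analysis.SpecialFunctions.Trigonometric.Basic
import Mathlib.Analysis.SpecialFunctions.Pow.Real
import Mathlib.Tactic
import HarnessLib

/-!
# Route GaussianScaleMixture — crux `RotationUpgradeFromTwoPoint` (stmt-CriticalPhenomena-8367),
# line `two-crystals-generate-so3`, stub `stub_twistIdentities`

THEOREM-ONLY file (no definitions, no named facts; the local notation
`E3 := EuclideanSpace ℝ (Fin 3)` is the skeleton's, so that the registered stub signature is
reproduced verbatim). **The two explicit twist identities** of the line, pure linear algebra on
`ℝ³ = E3` (coordinates `x 0, x 1, x 2`).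
With the symmetric orthogonal frame `W x = ((-x₀ + 2x₂)/√5, -x₁, (2x₀ + x₂)/√5)` (`W² = 1`,
`W e₂ = (2,0,1)/√5`), the coordinate rotations `R_z(φ)`, `R_x(φ)`, the special values `R_z(30°)`,
`R_x(90°)`, the rotation `R_{θ₀} = R_z(θ₀)` with `cos θ₀ = -1/4`, `sin θ₀ = √15/4`, and the signed
permutation `R_c x = (-x₂, x₁, x₀)` with inverse `x ↦ (x₂, x₁, -x₀)`:

1. `W (R_{θ₀} (W x)) = R_z(30°) (R_x(90°) (R_z(30°) x))` — the invariance-group element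
   `N = R_z(30°) R_x(90°) R_z(30°)` is the rotation by `θ₀ = arccos(-1/4)` about `(2,0,1)/√5`;
2. `R_c (W (R_z(φ) (W (R_c⁻¹ x)))) = W (R_x(φ) (W x))` — conjugating the circle `W R_z(·) W` by
   `R_c` gives the circle `W R_x(·) W` about the orthogonal axis `W e₀ = (-1,0,2)/√5`.

Proof: unfold the eight explicit maps coordinatewise (`simp` with the defining hypotheses and the
`![…]` evaluation simproc `Matrix.cons_val`) and compare the three coordinates. Identity 2 is
a polynomial identity in `x, cos φ, sin φ, (√5)⁻¹` on the nose (`ring`). Identity 1 holds modulo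
the four radical relations `√15 = √3·√5`, `√3·√3 = 3`, `√5·(√5)⁻¹ = 1`, `(√5)⁻¹·(√5)⁻¹ = 1/5`,
with explicit `linear_combination` certificates (no denominators are cleared: `(√5)⁻¹` is kept
as an atom). Nothing beyond Mathlib is used.
-/

namespace Summit.CriticalPhenomena.Ising3DConformalLimit.Cruxes.RotationUpgradeFromTwoPoint.TwoCrystalsGenerateSo3

local notation "E3" => EuclideanSpace ℝ (Fin 3)

/-- Two vectors of `ℝ³` written as `WithLp.toLp 2 ![a, b, c]` are equal as soon as their three
coordinates are. [folklore] -/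
theorem twi_toLp_ext {a b c a' b' c' : ℝ} (h0 : a = a') (h1 : b = b') (h2 : c = c') :
    (WithLp.toLp 2 ![a, b, c] : E3) = WithLp.toLp 2 ![a', b', c'] := by
  rw [h0, h1, h2]

/-- **Stub `stub_twistIdentities`.** The two explicit twist identities, with all eight maps given
in coordinates (`x = (x 0, x 1, x 2)`): the symmetric orthogonal frame
`W x = ((-x₀ + 2x₂)/√5, -x₁, (2x₀ + x₂)/√5)`, the rotations
`R_z(φ) x = (cos φ x₀ − sin φ x₁, sin φ x₀ + cos φ x₁, x₂)`,
`R_x(φ) x = (x₀, cos φ x₁ − sin φ x₂, sin φ x₁ + cos φ x₂)`, the special values `R_z(30°)`,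
`R_x(90°) x = (x₀, −x₂, x₁)`, `R_{θ₀} = R_z(θ₀)` with `cos θ₀ = -1/4`, `sin θ₀ = √15/4`, and the
signed permutation `R_c x = (−x₂, x₁, x₀)` (inverse `x ↦ (x₂, x₁, −x₀)`):
(1) `W (R_{θ₀} (W x)) = R_z(30°) (R_x(90°) (R_z(30°) x))`;
(2) `R_c (W (R_z(φ) (W (R_c⁻¹ x)))) = W (R_x(φ) (W x))` for all `φ`.
Coordinatewise polynomial identities in `√3, √5, √15 = √3·√5` (resp. `cos φ, sin φ, √5`).
[folklore] -/
theorem stub_twistIdentities :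
  ∀ (W Rz30 Rx90 Rth Rc Rcinv : E3 → E3) (Rz Rx : ℝ → E3 → E3),
    (∀ x, W x = WithLp.toLp 2 ![(-x 0 + 2 * x 2) / Real.sqrt 5, -x 1, (2 * x 0 + x 2) / Real.sqrt 5]) →
    (∀ x, Rz30 x = WithLp.toLp 2
      ![Real.sqrt 3 / 2 * x 0 - x 1 / 2, x 0 / 2 + Real.sqrt 3 / 2 * x 1, x 2]) →
    (∀ x, Rx90 x = WithLp.toLp 2 ![x 0, -x 2, x 1]) →
    (∀ x, Rth x = WithLp.toLp 2
      ![-(1 / 4) * x 0 - Real.sqrt 15 / 4 * x 1, Real.sqrt 15 / 4 * x 0 + -(1 / 4) * x 1, x 2]) →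
    (∀ x, Rc x = WithLp.toLp 2 ![-x 2, x 1, x 0]) →
    (∀ x, Rcinv x = WithLp.toLp 2 ![x 2, x 1, -x 0]) →
    (∀ φ x, Rz φ x = WithLp.toLp 2
      ![Real.cos φ * x 0 - Real.sin φ * x 1, Real.sin φ * x 0 + Real.cos φ * x 1, x 2]) →
    (∀ φ x, Rx φ x = WithLp.toLp 2
      ![x 0, Real.cos φ * x 1 - Real.sin φ * x 2, Real.sin φ * x 1 + Real.cos φ * x 2]) →
    (∀ x, W (Rth (W x)) = Rz30 (Rx90 (Rz30 x))) ∧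
    (∀ φ x, Rc (W (Rz φ (W (Rcinv x)))) = W (Rx φ (W x))) := by
  intro W Rz30 Rx90 Rth Rc Rcinv Rz Rx hW hRz30 hRx90 hRth hRc hRcinv hRz hRx
  constructor
  · intro x
    -- the radical relations; `(√5)⁻¹` is kept as an atom (no denominators are cleared)
    have h15 : Real.sqrt 15 = Real.sqrt 3 * Real.sqrt 5 := by
      rw [← Real.sqrt_mul (by norm_num : (0 : ℝ) ≤ 3)]
      norm_num
    have h3 : Real.sqrt 3 * Real.sqrt 3 = 3 := Real.mul_self_sqrt (by norm_num)
    have h5 : Real.sqrt 5 * (Real.sqrt 5)⁻¹ = 1 :=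
      mul_inv_cancel₀ (Real.sqrt_ne_zero'.mpr (by norm_num))
    have h5' : (Real.sqrt 5)⁻¹ * (Real.sqrt 5)⁻¹ = 1 / 5 := by
      rw [← mul_inv, Real.mul_self_sqrt (by norm_num : (0 : ℝ) ≤ 5), one_div]
    simp only [hW, hRth, hRz30, hRx90, Matrix.cons_val, h15]
    refine twi_toLp_ext ?_ ?_ ?_
    · linear_combination
        ((1 / 4) * (-x 0 + 2 * x 2) + 2 * (2 * x 0 + x 2)) * h5'
        - Real.sqrt 3 / 4 * x 1 * h5 - x 0 / 4 * h3
    · linear_combination -(Real.sqrt 3 / 4) * (-x 0 + 2 * x 2) * h5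
    · linear_combination
        (-(1 / 2) * (-x 0 + 2 * x 2) + (2 * x 0 + x 2)) * h5' + Real.sqrt 3 / 2 * x 1 * h5
  · intro φ x
    simp only [hRcinv, hW, hRz, hRc, hRx, Matrix.cons_val]
    exact twi_toLp_ext (by ring) (by ring) (by ring)

end Summit.CriticalPhenomena.Ising3DConformalLimit.Cruxes.RotationUpgradeFromTwoPoint.TwoCrystalsGenerateSo3
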